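import Summits.QuantumFields.YangMills.Theorems.BalabanUVNodesN09AxialCovariance181OnDomains
import Summits.QuantumFields.YangMills.Theorems.BalabanUVNodesN09BackgroundRadiiTransfer

/-!
# NODE N09 — THE ON-DOMAINS door with [B11] Thm 1 KEYED AT ONE RADIUS and the selection clause REDUCED TO THE AXIAL CONVENTION: dag-n09-w3's
# `thm3Member_forall_stage13SepCoPH_onDomains` with `hcov` ∕ `hsolv` ∕ `huniqDom` ALL DERIVED — from `h11` ([B11] Thm 1 at radius `θ.εbg`), dag-n09-w1 g2's (8)-membership
# clause `hreg8` + `hle : θ.ν.εreg ≤ θ.εbg`, and `haxDom` ([I] (2.3)'s block axial gauge of the critical configuration on the small-field domains)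

TRACK A (YM-PLAN §2d, node N09 of 28), seat `pub-ymgap-dag-n09-w2` (D-0149 width seat 2∕4), generation g2, FILE 7.  Key of record: K1⁷ `StabilityBAtRecordR13SepCoPH` =
stmt-QuantumFields-20542; `--supports` it as a helper (Summits lane).  [I] = [Balaban1987RG1] (CMP 109), [B11] = [Balaban1985Variational] (CMP 102).

WHY.  Three width seats of N09 each removed one displayed binder of dag-n09-w3's on-domains door (p589797 §4): this seat's FILE 6 (`…N09AxialCovariance181OnDomains`, p594969)
replaced the (181)ˢᵒˡ covariance `hcov` by `huniqDom` + `haxDom`; dag-n09-w1 g2's `…N09BackgroundRadiiTransfer` (p594365) derives the `εreg`-keyed [B11] inputs on the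
small-field domains — `hsolv` (`ukExists_εreg_of_h11_of_reg8`) and `huniqDom` (`uniqueUkOrbit_εreg_of_h11_of_reg8`) — from the junction's own `εbg`-keyed slot `h11` plus the
(8)-membership clause `hreg8` («the radius-`θ.εbg` background of record of every small field is `θ.ν.εreg`-regular», [B11] Thm 1 (8)) and `hle : θ.ν.εreg ≤ θ.εbg`.  THIS FILE
composes the two BY NAME: the door's SELECTION-side hypotheses shrink to `haxDom` ALONE (print's convention (2.3) for the record's `critCfgOfRecord`; FILE 5 prices the one-token
re-point that makes it a theorem), next to `hreg8`, `hle`, (F7a-dom) `hχreg`, (I19) `hint` (or (H-U)), [B11] ×3 at radius `θ.εbg` (`h11 ∕ hres ∕ huniq`) and the nesting `hnestreg`.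
* ★★★ `thm3Member_forall_stage13SepCoPH_onDomains_of_axialOn_of_reg8` — N24's `h09T` at a world bound to the Stage-13 v1.7 construction from `haxDom`, `hreg8`, `hle`, `hχreg`,
  `hint`, `h11`, `hres`, `huniq`, `hnestreg` (FILE 6 `thm3Member_forall_stage13SepCoPH_onDomains_of_uniqueOrbit_of_axialOn` fed by dag-n09-w1 g2's two letters);
  `…_of_measurableUk` twin ((I19) ↦ (H-U)); `b12_main_forall_…` corollary with N09's own leaf.
LOCATED (not settled here): `haxDom` (axial convention; node00-def's re-point), `hreg8` + `hle` (dag-n09-w1 g2's located reading: supplied for a print-admissible radius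
`B₃ε₀ ≤ εreg ≤ εbg ≤ a₀` modulo N07's Theorem-1 slot; at the V18 witness `εbg = 1 > a₀` it is NOT), (F7a-dom) (K0e's analytic debt on regular fields), (I19)∕(H-U), [B11] ×3
at `θ.εbg` (N07), the nesting — all DISPLAYED.

HONEST FRAMING: count-neutral composition BY NAME (FILE 6, dag-n09-w1 g2's radius transfer, dag-n09-w3's door, dag-n24-c's junction); NOTHING of Bałaban's asserted; N09 NOT
discharged; K0⁷ ∕ K1⁷ OPEN; counts unmoved (typed 28∕28 · discharged 5∕27); R4 is the conditional finite-𝕋⁴ rung `BalabanLadder.UV` only — NOT continuum ∕ ℝ⁴ ∕ OS ∕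
mass gap ∕ Clay.  THEOREMS ONLY (0 `def`, 0 `sorry`), standard axioms.
-/

noncomputable section

namespace Summit.QuantumFields.YangMills.BalabanUVNodes.N09AxialCovariance181OnDomainsReg8

open MeasureTheory
open Literature.MathematicalPhysics.QuantumFieldTheory.Balaban1983to89
open Literature.MathematicalPhysics.QuantumFieldTheory.Balaban1983to89.Node00
open B12RTGaugeInvariance254 (liftTransf)
open B12NodeKnitRecord8 (b12_main_of_leaf_of_thm3Member)
open DagBinding
open GaugeField (gaugeAct)
open Summit.QuantumFields.YangMills.BalabanUVNodes.N09AxialCovariance181OnDomains (thm3Member_forall_stage13SepCoPH_onDomains_of_uniqueOrbit_of_axialOn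
  thm3Member_forall_stage13SepCoPH_onDomains_of_uniqueOrbit_of_axialOn_of_measurableUk)
open Summit.QuantumFields.YangMills.BalabanUVNodes.N09BackgroundRadiiTransfer (ukExists_εreg_of_h11_of_reg8 uniqueUkOrbit_εreg_of_h11_of_reg8)

variable {F : T4Continuum.T4Family} {N : ℕ} [NeZero N]

/-- ★★★ **N24's `h09T` AT A WORLD BOUND TO THE STAGE-13 v1.7 CONSTRUCTION, ON THE SMALL-FIELD DOMAINS — [B11] THM 1 AT ONE RADIUS, SELECTION CLAUSE = THE AXIAL
CONVENTION ALONE**: dag-n09-w3's `thm3Member_forall_stage13SepCoPH_onDomains` (p589797) with `hcov`, `hsolv` and `huniqDom` DERIVED: FILE 6's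
`thm3Member_forall_stage13SepCoPH_onDomains_of_uniqueOrbit_of_axialOn` fed by dag-n09-w1 g2's `ukExists_εreg_of_h11_of_reg8` and `uniqueUkOrbit_εreg_of_h11_of_reg8`.
Displayed: `hreg8` ((8)-membership at radius `θ.εbg`), `hle`, `haxDom` ([I] (2.3)'s convention on `domAlt_{j+1}` for a contour family `cd P j`, e.g. def-B's
`contourOfRecord F N P.K j`), (F7a-dom) `hχreg`, (I19) `hint`, [B11] ×3 at `θ.εbg` (`h11 ∕ hres ∕ huniq`), the nesting `hnestreg`.  CONDITIONAL on every displayed hypothesis;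
nothing of Bałaban asserted; N09 NOT discharged; K1⁷ NOT closed.
[cite: Balaban1987RG1, Thm 3 p.264, (1.1)–(1.3) p.260, (2.1)–(2.3) p.265, (2.9)–(2.10) pp.266–267; Balaban1985Variational, Thm 1 (6), (8)–(10) p.279 and (181) p.307] -/
theorem thm3Member_forall_stage13SepCoPH_onDomains_of_axialOn_of_reg8 (θ : Stage13HParams F N) (h : θ.Provisos₁₃SepCoPH F N) {w : WorldP}
    (hC : w.C = (datumOfRecord₁₃SepCoPH F N θ h).C) (cd : (P : B12.RunParams) → (j : ℕ) → ContourData (F.P P.K) j (SU N))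
    (hreg8 : ∀ (P : B12.RunParams) (k : ℕ), k ≤ P.K → ∀ V ∈ domAltOfRecord F N θ.ν P.K k, Uk F N P.K k θ.εbg V ∈ bgReg F N P.K k θ.ν.εreg)
    (hle : θ.ν.εreg ≤ θ.εbg)
    (haxDom : ∀ (P : B12.RunParams), ∀ j < P.K, ∀ W ∈ domAltOfRecord F N θ.ν P.K (j + 1), AxialGauge (cd P j) (critCfgOfRecord F N θ.ν P.K j W))
    (hχreg : ∀ (P : B12.RunParams) (i : ℕ), i + 1 < P.K → ∀ᵐ U ∂(fieldMeasure (F.P P.K) (i + 1) (SU N)),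
      (avOfRecord F N P.K (i + 1)).avg U ∈ domAltOfRecord F N θ.ν P.K (i + 2) →
        U ∉ regSetOfRecord F N P.K i (betaInputOfRecord F N (TβOfRecord₁₃ F N) (chiβOfRecord₁₃ F N θ.toStage13Params) P.K (gOfRecord₁₃ F N θ.toStage13Params P) i) ∩
            domAltOfRecord F N θ.ν P.K (i + 1) →
          chiβOfRecord₁₃ F N θ.toStage13Params P.K (gOfRecord₁₃ F N θ.toStage13Params P) (i + 1) U = 0)
    (hint : ∀ (P : B12.RunParams), ∀ j < P.K, Integrable (betaInputOfRecord F N (TβOfRecord₁₃ F N) (chiβOfRecord₁₃ F N θ.toStage13Params) P.K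
      (gOfRecord₁₃ F N θ.toStage13Params P) j) (fieldMeasure (F.P P.K) j (SU N)))
    (h11 : ∀ (P : B12.RunParams) (k : ℕ), k ≤ P.K → ∀ V ∈ domAltOfRecord F N θ.ν P.K k, UkExists F N P.K k θ.εbg V ∧ UniqueUkOrbit F N P.K k θ.εbg V)
    (hres : ∀ (P : B12.RunParams) (k : ℕ), k ≤ P.K → HRestrict F N θ.εbg P.K k (domAltOfRecord F N θ.ν P.K k))
    (huniq : ∀ (P : B12.RunParams) (k : ℕ), k ≤ P.K → ∀ V ∈ domAltOfRecord F N θ.ν P.K k, ∀ j < k,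
      UniqueUkOrbit F N P.K (j + 1) θ.εbg (Averaging.iter (avOfRecord F N P.K) (j + 1) (Uk F N P.K k θ.εbg V)))
    (hnestreg : ∀ (P : B12.RunParams) (k : ℕ), k ≤ P.K → ∀ V ∈ domAltOfRecord F N θ.ν P.K k, ∀ i, i + 1 < k →
      Averaging.iter (avOfRecord F N P.K) (i + 1) (Uk F N P.K k θ.εbg V) ∈
        regSetOfRecord F N P.K i (betaInputOfRecord F N (TβOfRecord₁₃ F N) (chiβOfRecord₁₃ F N θ.toStage13Params) P.K (gOfRecord₁₃ F N θ.toStage13Params P) i) ∩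
          domAltOfRecord F N θ.ν P.K (i + 1)) :
    ∀ P : B12.RunParams, (leavesP w P).smallCouplings → (leavesP w P).smallFieldInductive :=
  thm3Member_forall_stage13SepCoPH_onDomains_of_uniqueOrbit_of_axialOn θ h hC cd
    (fun P => ukExists_εreg_of_h11_of_reg8 θ.ν θ.εbg P.K (h11 P) (hreg8 P) hle)
    (fun P => uniqueUkOrbit_εreg_of_h11_of_reg8 θ.ν θ.εbg P.K (h11 P) (hreg8 P) hle) haxDom hχreg hint h11 hres huniq hnestreg

/-- **THE SAME WITH (I19) REPLACED BY (H-U)** (measurability of the level-`(k+1)` minimiser selection at radius `θ.ν.εreg`; dag-n24-c `integrable_betaInput_stage13_of_measurableUk`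
through FILE 6).  CONDITIONAL; N09 NOT discharged; K1⁷ NOT closed.
[cite: Balaban1987RG1, Thm 3 p.264, (0.19) p.255, (2.1)–(2.3) p.265, (2.9)–(2.10) pp.266–267; Balaban1985Variational, Thm 1 (6), (8)–(10) p.279 and (181) p.307] -/
theorem thm3Member_forall_stage13SepCoPH_onDomains_of_axialOn_of_reg8_of_measurableUk (θ : Stage13HParams F N) (h : θ.Provisos₁₃SepCoPH F N) {w : WorldP}
    (hC : w.C = (datumOfRecord₁₃SepCoPH F N θ h).C) (cd : (P : B12.RunParams) → (j : ℕ) → ContourData (F.P P.K) j (SU N))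
    (hreg8 : ∀ (P : B12.RunParams) (k : ℕ), k ≤ P.K → ∀ V ∈ domAltOfRecord F N θ.ν P.K k, Uk F N P.K k θ.εbg V ∈ bgReg F N P.K k θ.ν.εreg)
    (hle : θ.ν.εreg ≤ θ.εbg)
    (haxDom : ∀ (P : B12.RunParams), ∀ j < P.K, ∀ W ∈ domAltOfRecord F N θ.ν P.K (j + 1), AxialGauge (cd P j) (critCfgOfRecord F N θ.ν P.K j W))
    (hU : ∀ (P : B12.RunParams) (k : ℕ), k < P.K → Measurable (Uk F N P.K (k + 1) θ.ν.εreg))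
    (hχreg : ∀ (P : B12.RunParams) (i : ℕ), i + 1 < P.K → ∀ᵐ U ∂(fieldMeasure (F.P P.K) (i + 1) (SU N)),
      (avOfRecord F N P.K (i + 1)).avg U ∈ domAltOfRecord F N θ.ν P.K (i + 2) →
        U ∉ regSetOfRecord F N P.K i (betaInputOfRecord F N (TβOfRecord₁₃ F N) (chiβOfRecord₁₃ F N θ.toStage13Params) P.K (gOfRecord₁₃ F N θ.toStage13Params P) i) ∩
            domAltOfRecord F N θ.ν P.K (i + 1) →
          chiβOfRecord₁₃ F N θ.toStage13Params P.K (gOfRecord₁₃ F N θ.toStage13Params P) (i + 1) U = 0)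
    (h11 : ∀ (P : B12.RunParams) (k : ℕ), k ≤ P.K → ∀ V ∈ domAltOfRecord F N θ.ν P.K k, UkExists F N P.K k θ.εbg V ∧ UniqueUkOrbit F N P.K k θ.εbg V)
    (hres : ∀ (P : B12.RunParams) (k : ℕ), k ≤ P.K → HRestrict F N θ.εbg P.K k (domAltOfRecord F N θ.ν P.K k))
    (huniq : ∀ (P : B12.RunParams) (k : ℕ), k ≤ P.K → ∀ V ∈ domAltOfRecord F N θ.ν P.K k, ∀ j < k,
      UniqueUkOrbit F N P.K (j + 1) θ.εbg (Averaging.iter (avOfRecord F N P.K) (j + 1) (Uk F N P.K k θ.εbg V)))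
    (hnestreg : ∀ (P : B12.RunParams) (k : ℕ), k ≤ P.K → ∀ V ∈ domAltOfRecord F N θ.ν P.K k, ∀ i, i + 1 < k →
      Averaging.iter (avOfRecord F N P.K) (i + 1) (Uk F N P.K k θ.εbg V) ∈
        regSetOfRecord F N P.K i (betaInputOfRecord F N (TβOfRecord₁₃ F N) (chiβOfRecord₁₃ F N θ.toStage13Params) P.K (gOfRecord₁₃ F N θ.toStage13Params P) i) ∩
          domAltOfRecord F N θ.ν P.K (i + 1)) :
    ∀ P : B12.RunParams, (leavesP w P).smallCouplings → (leavesP w P).smallFieldInductive :=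
  thm3Member_forall_stage13SepCoPH_onDomains_of_uniqueOrbit_of_axialOn_of_measurableUk θ h hC cd
    (fun P => ukExists_εreg_of_h11_of_reg8 θ.ν θ.εbg P.K (h11 P) (hreg8 P) hle)
    (fun P => uniqueUkOrbit_εreg_of_h11_of_reg8 θ.ν θ.εbg P.K (h11 P) (hreg8 P) hle) haxDom hU hχreg h11 hres huniq hnestreg

/-- **N09 = `Dag.B12_main` AT EVERY RUN OF A WORLD BOUND TO THE STAGE-13 v1.7 CONSTRUCTION** from N09's own leaf `b12` ([I] Lemma 4) and the inputs of
`thm3Member_forall_stage13SepCoPH_onDomains_of_axialOn_of_reg8` (dag-n09-a `b12_main_of_leaf_of_thm3Member`).  CONDITIONAL; N09 NOT discharged.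
[cite: Balaban1987RG1, Lemma 4 (3.53) p.280, Thm 3 p.264 and (2.3) p.265; Balaban1985Variational, Thm 1 (8) p.279 and (181) p.307] -/
theorem b12_main_forall_stage13SepCoPH_onDomains_of_axialOn_of_reg8 (θ : Stage13HParams F N) (h : θ.Provisos₁₃SepCoPH F N) {w : WorldP}
    (hC : w.C = (datumOfRecord₁₃SepCoPH F N θ h).C) (h12 : ∀ P : B12.RunParams, (leavesP w P).b12)
    (cd : (P : B12.RunParams) → (j : ℕ) → ContourData (F.P P.K) j (SU N))
    (hreg8 : ∀ (P : B12.RunParams) (k : ℕ), k ≤ P.K → ∀ V ∈ domAltOfRecord F N θ.ν P.K k, Uk F N P.K k θ.εbg V ∈ bgReg F N P.K k θ.ν.εreg)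
    (hle : θ.ν.εreg ≤ θ.εbg)
    (haxDom : ∀ (P : B12.RunParams), ∀ j < P.K, ∀ W ∈ domAltOfRecord F N θ.ν P.K (j + 1), AxialGauge (cd P j) (critCfgOfRecord F N θ.ν P.K j W))
    (hχreg : ∀ (P : B12.RunParams) (i : ℕ), i + 1 < P.K → ∀ᵐ U ∂(fieldMeasure (F.P P.K) (i + 1) (SU N)),
      (avOfRecord F N P.K (i + 1)).avg U ∈ domAltOfRecord F N θ.ν P.K (i + 2) →
        U ∉ regSetOfRecord F N P.K i (betaInputOfRecord F N (TβOfRecord₁₃ F N) (chiβOfRecord₁₃ F N θ.toStage13Params) P.K (gOfRecord₁₃ F N θ.toStage13Params P) i) ∩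
            domAltOfRecord F N θ.ν P.K (i + 1) →
          chiβOfRecord₁₃ F N θ.toStage13Params P.K (gOfRecord₁₃ F N θ.toStage13Params P) (i + 1) U = 0)
    (hint : ∀ (P : B12.RunParams), ∀ j < P.K, Integrable (betaInputOfRecord F N (TβOfRecord₁₃ F N) (chiβOfRecord₁₃ F N θ.toStage13Params) P.K
      (gOfRecord₁₃ F N θ.toStage13Params P) j) (fieldMeasure (F.P P.K) j (SU N)))
    (h11 : ∀ (P : B12.RunParams) (k : ℕ), k ≤ P.K → ∀ V ∈ domAltOfRecord F N θ.ν P.K k, UkExists F N P.K k θ.εbg V ∧ UniqueUkOrbit F N P.K k θ.εbg V)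
    (hres : ∀ (P : B12.RunParams) (k : ℕ), k ≤ P.K → HRestrict F N θ.εbg P.K k (domAltOfRecord F N θ.ν P.K k))
    (huniq : ∀ (P : B12.RunParams) (k : ℕ), k ≤ P.K → ∀ V ∈ domAltOfRecord F N θ.ν P.K k, ∀ j < k,
      UniqueUkOrbit F N P.K (j + 1) θ.εbg (Averaging.iter (avOfRecord F N P.K) (j + 1) (Uk F N P.K k θ.εbg V)))
    (hnestreg : ∀ (P : B12.RunParams) (k : ℕ), k ≤ P.K → ∀ V ∈ domAltOfRecord F N θ.ν P.K k, ∀ i, i + 1 < k →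
      Averaging.iter (avOfRecord F N P.K) (i + 1) (Uk F N P.K k θ.εbg V) ∈
        regSetOfRecord F N P.K i (betaInputOfRecord F N (TβOfRecord₁₃ F N) (chiβOfRecord₁₃ F N θ.toStage13Params) P.K (gOfRecord₁₃ F N θ.toStage13Params P) i) ∩
          domAltOfRecord F N θ.ν P.K (i + 1)) :
    ∀ P : B12.RunParams, Dag.B12_main (leavesP w P) :=
  fun P => b12_main_of_leaf_of_thm3Member (h12 P)
    (thm3Member_forall_stage13SepCoPH_onDomains_of_axialOn_of_reg8 θ h hC cd hreg8 hle haxDom hχreg hint h11 hres huniq hnestreg P)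

end Summit.QuantumFields.YangMills.BalabanUVNodes.N09AxialCovariance181OnDomainsReg8
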